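import Summits.QuantumFields.BalabanUV.Beta.RemainderExplicitTorusColumn
import Literature.MathematicalPhysics.QuantumFieldTheory.Balaban1983to89.B12Decay510Torus

/-!
# Beta / RemainderExplicitCarrierSpaces — BINDER-OWNERS row D4, ROAD P3 (co-owner #3, unit `b2b-balaban-beta-d4-p3`), skeleton leaf E3.0:
# THE (3.14)/(4.4)-TYPE NORMED CONFIGURATION SPACES OF THE EXPLICIT CARRIER — complex 1-forms on a finite fine torus, normed by
# `max{ sup|A|, sup_S N·|∇A|, sup_S N²·|Δ_vec A|, sup_S N²·|d d* A| }` (`S` = the fine sites over a localization domain)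

HONEST FRAMING (page 1 of everything the β sub-cell writes): discharging `BetaPertH` makes Bałaban's UV stability
UNCONDITIONAL — a real constructive-QFT result; it is NOT the continuum limit and NOT the Clay problem.  HONEST DEPENDENCY
(verbatim): «continuum YM on T⁴ ⇐ BetaPertH ∧ nine spine estimates (0/9 proved); BetaPertH ⇐ (D1) ∧ (D4) ∧ CAP+tail;
G-an2-4 gates asym, D1 and NE2/3/4.»  NOT IN PRINT; OUR BOOKKEEPING.  `[folklore]` normed-space plumbing (`NormedAddCommGroup.induced` /
`NormedSpace.induced` along an injective linear map into a product of sup-normed function spaces).  No cited fact, no wall binder, no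
`def … : Prop`; nothing about Bałaban's densities is asserted.  NOT summit progress.

ABSOLUTE RULE (cell charter, verbatim): "No internally-minted statement may enter as a cited fact. Every hypothesis is
either kernel-proved in this package or a verbatim quotation of a PUBLISHED theorem with page reference. The manuscript(s)
under audit are NOT citable for their own disputed steps — they are the thing under adjudication; programme-internal
(2001/route/tribunal) claims are never citable."

## What is here and what is READ, not asserted

[Balaban1987RG1] (4.4) p. 281: `max{|𝐀|_X, |P₁(□₀)𝐀|_X, |∇^ξ𝐀|_X, |Δ^ξ𝐀|_X} < α₂` (with (3.14) p. 272).  The space `RCfg Nf s S` below is the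
space of complex 1-forms on the fine torus `(ℤ/Nf)^4` with the norm `max{sup_all |A|, sup_{z∈S} s·|A(z+e_ν)−A(z)|, sup_{z∈S} s²·|Δ_vec A(z)|,
sup_{z∈S} s²·|dz (codiff₁ A)(z)|}` (`s = ξ⁻¹ = N` the block side, stencils evaluated on the periodic extension).  READING (part of the
residual (R.d)/(R.e) of `RemainderExplicitRoad`, NOT asserted here): on weak-Landau-gauge configurations `P₁ = d(1 − R)d* = d d*` ([I] p. 272,
[Balaban1984PropagatorsI] (1.44)/(1.49)), so on road P3's test configurations this norm dominates print's (4.4) norm — the honest direction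
(a smaller ball asks less analyticity of print's `𝐄^{(j)}(X, ·)`).
-/

noncomputable section

open Finset
open scoped BigOperators
open Literature.Probability.LatticeModels (TorusSite)
open Literature.MathematicalPhysics.QuantumFieldTheory.Balaban1983to89
open Literature.MathematicalPhysics.QuantumFieldTheory.Balaban1983to89.Beta
open Literature.MathematicalPhysics.QuantumFieldTheory.Balaban1983to89.TreeLengthTorus (TPt proj natLift)
open AffineAveraging (Site Form1 unitVec dz codiff₁)
open BlochFibreMatrix (dz_add' dz_smul' codiff₁_add' codiff₁_smul')

namespace Summit.QuantumFields.BalabanUV.Beta.RemainderExplicitCarrierSpaces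

/-! ## §1 Complex stencils on the periodic extension -/

/-- [folklore] The componentwise lattice Laplacian on complex 1-forms (same formula as `RemainderExplicitSecondOrder.lapVec`). -/
def lapVecC {d : ℕ} (A : Form1 d ℂ) : Form1 d ℂ := fun ν x => ∑ μ, (2 * A ν x - A ν (x + unitVec μ) - A ν (x - unitVec μ))

/-- [folklore] `lapVecC` is additive. -/
theorem lapVecC_add {d : ℕ} (A B : Form1 d ℂ) : lapVecC (A + B) = lapVecC A + lapVecC B := by
  funext ν x; simp only [lapVecC, Pi.add_apply, ← Finset.sum_add_distrib]; exact Finset.sum_congr rfl fun _ _ => by ring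

/-- [folklore] `lapVecC` is homogeneous. -/
theorem lapVecC_smul {d : ℕ} (a : ℂ) (A : Form1 d ℂ) : lapVecC (a • A) = a • lapVecC A := by
  funext ν x; simp only [lapVecC, Pi.smul_apply, smul_eq_mul, Finset.mul_sum]; exact Finset.sum_congr rfl fun _ _ => by ring

variable {Nf : ℕ}

/-- [folklore] The periodic extension to `ℤ⁴` of a 1-form on the fine torus `(ℤ/Nf)^4`. -/
def ext (A : Fin 4 × TPt 4 Nf → ℂ) : Form1 4 ℂ := fun κ z => A (κ, proj Nf z)

/-- [folklore] `ext` is additive. -/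
theorem ext_add (A B : Fin 4 × TPt 4 Nf → ℂ) : ext (A + B) = ext A + ext B := rfl

/-- [folklore] `ext` is homogeneous. -/
theorem ext_smul (a : ℂ) (A : Fin 4 × TPt 4 Nf → ℂ) : ext (a • A) = a • ext A := rfl

/-! ## §2 The normed restricted-configuration space -/

/-- **THE CONFIGURATION SPACE** (type synonym): complex 1-forms on the fine torus `(ℤ/Nf)^4`; the norm (below) depends on the block side
`s` and on the stencil window `S` (the fine sites over a localization domain). [folklore] -/
def RCfg (Nf : ℕ) (_s : ℝ) (_S : Finset (TPt 4 Nf)) : Type := Fin 4 × TPt 4 Nf → ℂ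

variable {s : ℝ} {S : Finset (TPt 4 Nf)}

/-- The additive group structure (pointwise). [folklore] -/
instance instAddCommGroup : AddCommGroup (RCfg Nf s S) := Pi.addCommGroup

/-- The ℂ-module structure (pointwise). [folklore] -/
instance instModule : Module ℂ (RCfg Nf s S) := Pi.module _ _ _

/-- The underlying function of a configuration. [folklore] -/
def val (A : RCfg Nf s S) : Fin 4 × TPt 4 Nf → ℂ := A

/-- The target of the norm-defining embedding: four sup-normed function spaces. [folklore] -/
abbrev Target (Nf : ℕ) : Type :=
  (Fin 4 × TPt 4 Nf → ℂ) × ((Fin 4 × Fin 4 × TPt 4 Nf → ℂ) × ((Fin 4 × TPt 4 Nf → ℂ) × (Fin 4 × TPt 4 Nf → ℂ)))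

/-- The η-scaled gradient component on the window: `1_S(z)·s·(A_κ(z+e_ν) − A_κ(z))`. [folklore] -/
def gradC (s : ℝ) (S : Finset (TPt 4 Nf)) (A : Fin 4 × TPt 4 Nf → ℂ) : Fin 4 × Fin 4 × TPt 4 Nf → ℂ :=
  fun i => if i.2.2 ∈ S then (s : ℂ) * (ext A i.2.1 (natLift i.2.2 + unitVec i.1) - ext A i.2.1 (natLift i.2.2)) else 0

/-- The η-scaled Laplacian component on the window: `1_S(z)·s²·(Δ_vec A)_ν(z)`. [folklore] -/
def lapC (s : ℝ) (S : Finset (TPt 4 Nf)) (A : Fin 4 × TPt 4 Nf → ℂ) : Fin 4 × TPt 4 Nf → ℂ :=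
  fun i => if i.2 ∈ S then (s : ℂ) ^ 2 * lapVecC (ext A) i.1 (natLift i.2) else 0

/-- The η-scaled `d d*` component on the window: `1_S(z)·s²·(dz (codiff₁ A))_ν(z)`. [folklore] -/
def ddC (s : ℝ) (S : Finset (TPt 4 Nf)) (A : Fin 4 × TPt 4 Nf → ℂ) : Fin 4 × TPt 4 Nf → ℂ :=
  fun i => if i.2 ∈ S then (s : ℂ) ^ 2 * dz (codiff₁ (ext A)) i.1 (natLift i.2) else 0

/-- [folklore] `gradC` is additive. -/
theorem gradC_add (A B : Fin 4 × TPt 4 Nf → ℂ) : gradC s S (A + B) = gradC s S A + gradC s S B := by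
  funext i; simp only [gradC, ext_add, Pi.add_apply]; split_ifs <;> ring

/-- [folklore] `gradC` is homogeneous. -/
theorem gradC_smul (a : ℂ) (A : Fin 4 × TPt 4 Nf → ℂ) : gradC s S (a • A) = a • gradC s S A := by
  funext i; simp only [gradC, ext_smul, Pi.smul_apply, smul_eq_mul]; split_ifs <;> ring

/-- [folklore] `lapC` is additive. -/
theorem lapC_add (A B : Fin 4 × TPt 4 Nf → ℂ) : lapC s S (A + B) = lapC s S A + lapC s S B := by
  funext i; simp only [lapC, ext_add, lapVecC_add, Pi.add_apply]; split_ifs <;> ring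

/-- [folklore] `lapC` is homogeneous. -/
theorem lapC_smul (a : ℂ) (A : Fin 4 × TPt 4 Nf → ℂ) : lapC s S (a • A) = a • lapC s S A := by
  funext i; simp only [lapC, ext_smul, lapVecC_smul, Pi.smul_apply, smul_eq_mul]; split_ifs <;> ring

/-- [folklore] `ddC` is additive. -/
theorem ddC_add (A B : Fin 4 × TPt 4 Nf → ℂ) : ddC s S (A + B) = ddC s S A + ddC s S B := by
  funext i; simp only [ddC, ext_add, codiff₁_add', dz_add', Pi.add_apply]; split_ifs <;> ring

/-- [folklore] `ddC` is homogeneous. -/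
theorem ddC_smul (a : ℂ) (A : Fin 4 × TPt 4 Nf → ℂ) : ddC s S (a • A) = a • ddC s S A := by
  funext i; simp only [ddC, ext_smul, codiff₁_smul', dz_smul', Pi.smul_apply, smul_eq_mul]; split_ifs <;> ring

variable [NeZero Nf]

/-- **THE NORM-DEFINING EMBEDDING** `A ↦ (A, ∇-part, Δ-part, dd*-part)`, ℂ-linear. [folklore] -/
def embed (s : ℝ) (S : Finset (TPt 4 Nf)) : RCfg Nf s S →ₗ[ℂ] Target Nf where
  toFun A := (val A, (gradC s S (val A), (lapC s S (val A), ddC s S (val A))))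
  map_add' A B := by
    have hv : val (A + B) = val A + val B := rfl
    rw [hv, gradC_add, lapC_add, ddC_add]
    rfl
  map_smul' a A := by
    have hv : val (a • A) = a • val A := rfl
    rw [hv, gradC_smul, lapC_smul, ddC_smul]
    rfl

omit [NeZero Nf] in
/-- [folklore] The embedding is injective (its first component is the identity). -/
theorem embed_injective (s : ℝ) (S : Finset (TPt 4 Nf)) : Function.Injective (embed (Nf := Nf) s S) :=
  fun _ _ h => congrArg Prod.fst h

/-- **THE (3.14)/(4.4)-TYPE NORM**: `‖A‖ := ‖embed A‖ = max{sup|A|, sup_S s|∇A|, sup_S s²|Δ_vec A|, sup_S s²|dd*A|}`. [folklore] -/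
instance instNormedAddCommGroup : NormedAddCommGroup (RCfg Nf s S) :=
  NormedAddCommGroup.induced (RCfg Nf s S) (Target Nf) (embed s S) (embed_injective s S)

/-- The complex normed-space structure. [folklore] -/
instance instNormedSpace : NormedSpace ℂ (RCfg Nf s S) := NormedSpace.induced ℂ (RCfg Nf s S) (Target Nf) (embed s S)

/-- [folklore] The norm is the norm of the embedded quadruple. -/
theorem norm_def (A : RCfg Nf s S) : ‖A‖ = ‖embed s S A‖ := rfl

/-- [folklore] **COMPONENTWISE CRITERION**: if `B ≥ 0` bounds `|A|` everywhere and the three scaled stencils on the window `S`, then `‖A‖ ≤ B`. -/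
theorem norm_le_of_components (A : RCfg Nf s S) {B : ℝ} (hB : 0 ≤ B)
    (h0 : ∀ κ z, ‖val A (κ, z)‖ ≤ B)
    (h1 : ∀ ν κ z, z ∈ S → ‖(s : ℂ) * (ext (val A) κ (natLift z + unitVec ν) - ext (val A) κ (natLift z))‖ ≤ B)
    (h2 : ∀ ν z, z ∈ S → ‖(s : ℂ) ^ 2 * lapVecC (ext (val A)) ν (natLift z)‖ ≤ B)
    (h3 : ∀ ν z, z ∈ S → ‖(s : ℂ) ^ 2 * dz (codiff₁ (ext (val A))) ν (natLift z)‖ ≤ B) :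
    ‖A‖ ≤ B := by
  rw [norm_def]
  refine max_le ?_ (max_le ?_ (max_le ?_ ?_))
  · exact (pi_norm_le_iff_of_nonneg hB).2 fun i => h0 i.1 i.2
  · refine (pi_norm_le_iff_of_nonneg hB).2 fun i => ?_
    show ‖gradC s S (val A) i‖ ≤ B
    unfold gradC; split_ifs with h
    · exact h1 i.1 i.2.1 i.2.2 h
    · simpa using hB
  · refine (pi_norm_le_iff_of_nonneg hB).2 fun i => ?_
    show ‖lapC s S (val A) i‖ ≤ B
    unfold lapC; split_ifs with h
    · exact h2 i.1 i.2 h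
    · simpa using hB
  · refine (pi_norm_le_iff_of_nonneg hB).2 fun i => ?_
    show ‖ddC s S (val A) i‖ ≤ B
    unfold ddC; split_ifs with h
    · exact h3 i.1 i.2 h
    · simpa using hB

/-- [folklore] Every coordinate is bounded by the norm: `‖A(κ, z)‖ ≤ ‖A‖`. -/
theorem norm_apply_le (A : RCfg Nf s S) (κ : Fin 4) (z : TPt 4 Nf) : ‖val A (κ, z)‖ ≤ ‖A‖ := by
  rw [norm_def]
  refine le_trans ?_ (le_max_left _ _)
  exact norm_le_pi_norm (val A) (κ, z)

/-- [folklore] The coordinate evaluation as a continuous linear map (bounded by `1` through `norm_apply_le`). -/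
def evalCLM (s : ℝ) (S : Finset (TPt 4 Nf)) (i : Fin 4 × TPt 4 Nf) : RCfg Nf s S →L[ℂ] ℂ :=
  LinearMap.mkContinuous
    { toFun := fun A => val A i, map_add' := fun _ _ => rfl, map_smul' := fun _ _ => rfl } 1
    fun A => by rw [one_mul]; exact norm_apply_le A i.1 i.2

/-- [folklore] `evalCLM i A = A i`. -/
theorem evalCLM_apply (i : Fin 4 × TPt 4 Nf) (A : RCfg Nf s S) : evalCLM s S i A = val A i := rfl

end Summit.QuantumFields.BalabanUV.Beta.RemainderExplicitCarrierSpaces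

end
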